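import Mathlib
import Summits.Ventures.HodgeRepro.Tier4.Target
import Summits.Ventures.HodgeRepro.Tier4.Line3.Defs
import Summits.Ventures.HodgeRepro.Tier4.Line3.DefsLemmas
import Summits.Ventures.HodgeRepro.Tier4.Line3.HeckeEquivarianceLemmas
import Summits.Ventures.HodgeRepro.Tier4.Line3.TorusInvariance
import Summits.Ventures.HodgeRepro.Tier4.Line3.CoefInvariance
import Summits.Ventures.HodgeRepro.Tier4.Line3.ClassRegrouping
import Summits.Ventures.HodgeRepro.Tier4.Line3.MainClassReps
import Summits.Ventures.HodgeRepro.Tier4.Line3.ClassFibres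
import Summits.Ventures.HodgeRepro.Tier4.Line3.CoefMajorantWitness
import Summits.Ventures.HodgeRepro.Tier4.Line3.Witness.ThetaDataWitnessCf
import Summits.Ventures.HodgeRepro.Tier4.Line3.LocSScalarObstructionGen
import Summits.Ventures.HodgeRepro.Tier4.Line3.UnitCopyScaling
import Summits.Ventures.HodgeRepro.Tier4.Line3.UnitCopyTerm

/-!
# Tier4/Line3/UnitCopyPos — from `LocPS.pos` on the main classes to the per-slot scalar copies

Blind re-derivation cell `pub-hodge-repro`, Tier 4 «PROVE THE STEP», LINE L3, seat t4-L3-p2 (g2); bus S13539.  Glue for the family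
sum of the repaired line (plan-3 g3 S13492, x2 S13519): the clause `pos` of `LocPS` (coefficients non-negative real at the chosen
representatives `mainRep c` of the main classes) is transported to EVERY line tuple of the main orbit, for a SYMMETRIC centre
(`xm 2 = xm 0`, `xm 3 = xm 1`, so the kernel is `|wedge|²` on the whole orbit):

* `kernel_symm` — at a symmetric tuple the quadruple kernel is `normSq (wedge …)`, a non-negative real;
* **`summand_nonneg_of_pos`** — `pos` at `mainRep` + `coefQ_mulVec_mem_of_thetaData` (`Γ′`-invariance) + `mem_class_iff` give
  `(summand γ w z).im = 0 ∧ 0 ≤ re` for every `w` in the main orbit and every `z`;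
* `gaussRatio_const_on_orbit` — the Gaussian ratio of a per-slot copy is the same at every representative of the main orbit;
* **`term_scaleLine_eq_of_pos`** — hence, under the per-slot scalar symmetries, the orbital term of the copy `ε • xm` is
  `Λ(ε) · gaussRatio ε xm · T′` with `T′ ≥ 0` (UnitCopyTerm's `term_scaleLine_eq` with `pos` in place of the orbit-wise
  hypothesis and the constant Gaussian ratio pulled out).

Nothing here says anything about the status of the Hodge conjecture for CM abelian varieties, which is NOT proved
(HC_CM is NOT proved by anyone in this repository).
-/

set_option autoImplicit false

noncomputable section

namespace Summit.Ventures.HodgeRepro.Tier4.Line3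

open Summit.Ventures.HodgeRepro.Tier4
open Matrix NumberField MeasureTheory
open scoped ComplexConjugate

namespace T4Data

variable (X : T4Data)

/-- At a symmetric tuple (`y 2 = y 0`, `y 3 = y 1`) the quadruple kernel is `|wedge|²`. -/
theorem kernel_symm (Φ : KMDatumS) (y : X.Tuple) (h02 : y 2 = y 0) (h13 : y 3 = y 1) (z : Fin 2 → ℂ) :
    X.kernel Φ y z = ((Complex.normSq (wedge (fun k => datumS Φ (X.ballCoord (y 0)) z k)
      (fun k => datumS Φ (X.ballCoord (y 1)) z k)) : ℝ) : ℂ) := by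
  unfold T4Data.kernel
  rw [h02, h13, Complex.mul_conj]

/-- **THE SUMMANDS OF THE MAIN ORBIT ARE NON-NEGATIVE REALS** under `pos` at the class representatives, for a symmetric centre. -/
theorem summand_nonneg_of_pos (D : X.ThetaData) {K : X.Level} (γ : X.Tr K) (xm : X.Tuple) (h02 : xm 2 = xm 0)
    (h13 : xm 3 = xm 1)
    (hpos : ∀ c : X.MainClass K xm,
      (X.coefQ D.cf γ (X.mainRep K xm c)).im = 0 ∧ 0 ≤ (X.coefQ D.cf γ (X.mainRep K xm c)).re)
    {w : X.LineTuple} (hw : X.orbitOf w = X.orbitOf (X.lines xm)) (z : Fin 2 → ℂ) :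
    (X.summand D.Φ D.cf γ w z).im = 0 ∧ 0 ≤ (X.summand D.Φ D.cf γ w z).re := by
  let c : X.MainClass K xm := ⟨X.classOf K w, (X.orbitOf_out_classOf K w).trans hw⟩
  obtain ⟨g, hg, hwg⟩ := (X.mem_class_iff K xm c w).1 rfl
  rw [X.summand_eq_of_lines_eq D.Φ D.cf D.weight γ (w := w) (x := fun j => g *ᵥ X.mainRep K xm c j) hwg.symm z,
    X.coefQ_mulVec_mem_of_thetaData D γ hg]
  have hm02 : X.mainRep K xm c 2 = X.mainRep K xm c 0 := by
    show X.gRep K xm c *ᵥ xm 2 = X.gRep K xm c *ᵥ xm 0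
    rw [h02]
  have hm13 : X.mainRep K xm c 3 = X.mainRep K xm c 1 := by
    show X.gRep K xm c *ᵥ xm 3 = X.gRep K xm c *ᵥ xm 1
    rw [h13]
  rw [X.kernel_symm D.Φ (fun j => g *ᵥ X.mainRep K xm c j) (by simp only [hm02]) (by simp only [hm13]) z]
  obtain ⟨r, hr0, hr⟩ := exists_nonneg_ofReal (hpos c)
  rw [hr, ← Complex.ofReal_mul]
  exact ⟨Complex.ofReal_im _, by rw [Complex.ofReal_re]; exact mul_nonneg hr0 (Complex.normSq_nonneg _)⟩

/-- The Gaussian ratio of a per-slot copy is constant along the main orbit: `gaussDef` is unitary- and torus-invariant. -/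
theorem gaussRatio_const_on_orbit (ε : Fin 4 → X.E) (xm : X.Tuple) {w : X.LineTuple}
    (hw : X.orbitOf w = X.orbitOf (X.lines xm)) : X.gaussRatio ε (X.rep w) = X.gaussRatio ε xm := by
  obtain ⟨g, hg, rfl⟩ := X.exists_unitary_of_orbitOf_eq xm hw.symm
  obtain ⟨t, ht, hrep⟩ := X.exists_torus_rep_lines (fun j => g *ᵥ xm j)
  unfold gaussRatio
  rw [hrep]
  refine Finset.prod_congr rfl fun j _ => ?_
  simp only []
  rw [smul_comm, X.gaussDef_smul (ht j), X.gaussDef_smul (ht j), ← Matrix.mulVec_smul,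
    X.gaussDef_mulVec_of_unitary hg, X.gaussDef_mulVec_of_unitary hg]

/-- **THE ORBITAL TERM OF A PER-SLOT SCALAR COPY, FROM `pos`**: for a symmetric centre with `pos` at the class representatives
(the clause `LocPS.pos` at one depth) and the per-slot scalar symmetries of the data, the term of the copy `ε • xm` is the
archimedean phase times the Gaussian ratio times a non-negative real. -/
theorem term_scaleLine_eq_of_pos (D : X.ThetaData) {ε : Fin 4 → X.E} (hε : ∀ j, ε j ≠ 0) {lam : Fin 4 → ℂ}
    (hu : ∀ j, X.SlotScalarSymmetric D j (ε j) (lam j)) (K : X.Level) (γ : X.Tr K) (xm : X.Tuple)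
    (h02 : xm 2 = xm 0) (h13 : xm 3 = xm 1)
    (hpos : ∀ c : X.MainClass K xm,
      (X.coefQ D.cf γ (X.mainRep K xm c)).im = 0 ∧ 0 ≤ (X.coefQ D.cf γ (X.mainRep K xm c)).re) :
    ∃ T' : ℝ, 0 ≤ T' ∧ X.term D.Φ D.cf K γ (X.orbitOf (X.lines fun j => ε j • xm j)) =
      lam 0 * lam 1 * conj (lam 2 * lam 3) * ((X.gaussRatio ε xm : ℝ) : ℂ) * T' := by
  obtain ⟨T, hT, hterm⟩ := X.term_scaleLine_eq D hε hu K γ xm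
    (fun w hw z => X.summand_nonneg_of_pos D γ xm h02 h13 hpos hw z)
  refine ⟨T / X.gaussRatio ε xm, div_nonneg hT (X.gaussRatio_pos ε xm).le, ?_⟩
  rw [hterm]
  have hR : (X.gaussRatio ε xm : ℂ) ≠ 0 := Complex.ofReal_ne_zero.2 (X.gaussRatio_pos ε xm).ne'
  push_cast
  field_simp

end T4Data

end Summit.Ventures.HodgeRepro.Tier4.Line3

end
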